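import Summits.QuantumFields.YangMills.Theorems.BalabanUVNodesN22EdgeAtW1ReadingOfRecord12
import Summits.QuantumFields.YangMills.Theorems.BalabanUVNodesN22W1StripAdmReading

/-!
# THE EDGE N18 → N22 AT THE RATE READING OF RECORD WHOSE W1 COMPONENT IS THE ADMISSIBLE-SLOT READING `Node00.W1.ReadingData.ofRecordAdm` — θ-FORM AND STUB LEVEL
# (regime ∕ tuple home, strip currency; canonical and regime homes, analytic sup-letter currency): module 7 ∕ 7b with the pairing coherence (C1)(C2) AND the
# readings-in-the-spaces clause DISCHARGED BY TYPE, the backgrounds quantified over the ADMISSIBLE backgrounds `Node00.W1.AdmBg F M N sp k` only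

Track A of `YM-PLAN.md` (cell `pub-ymgap`, HUMAN RULING D-0062), R134 seat `pub-ymgap-dag-n22-e` ((T-RATE) pen ∕ N22 NE9 s2 «`FadingMemory` by name from a modulus + knit at
the ₁₂ record»), gen 4, module 8a.  THEOREMS ONLY (no `def`, no `sorry`); `--supports` K3″ `SpineGivenEndpointR12` (stmt-QuantumFields-19908) as a helper; restate-immune
(no Theses import).

WHY.  dag-n22-c g3's LOCATED-BGA (pub-ymgap bus, 2026-08-27): at W1 g3's reading of record `ReadingData.ofRecord` the run-A ∕ run-B slots are ALL `SU(N)` gauge fields, so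
every STRIP ∕ (1.18)-based producer's clause «the readings `(ιU, 0)` lie in the spaces `U^c_j(Y, α₀, α₁)` of record» is FALSE there (a plaquette far from `1`), and every
rate statement keyed to that reading is located-vacuous in that clause.  Repair (R1), typed by dag-n22-c g3 and filed by node00-def-W1 g4: `Node00/RateRecordW1MapsAdm.lean`
— the reading `ReadingData.ofRecordAdm F M N S sp gauge hg T₀ hT₀ li` whose background slots are the ADMISSIBLE backgrounds `AdmBg F M N sp k` of ONE space-table family
`sp` (the readings lie in the spaces BY TYPE, `LevelPairing.ofRecordAdm_embA_mem`; run B of pairing `k` IS run A of pairing `k + 1`).  This module re-instantiates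
module 7's θ-form and module 7b's three stub-level edges at that reading, as dag-lead's table asks («n18-d ∕ n18-c ∕ n22-e re-instantiate at `ofRecordAdm` by name»):
the coherence (C1)(C2) is dag-n22-c's `YMDAG.N22.W1.pairingCoherence_ofRecordAdm` (their module 13, p482103: `rfl` ∕ `dj_pairOfRecord` ∕ `range_pairOfRecord` ∕
`⟨U, rfl⟩`) BY NAME, the readings clause is the slot's TYPE, and the regularity letters (STRIP ∕ (A)) and node N18's stub are asked over ADMISSIBLE backgrounds only.
ONE ENGINE PER CONTENT: dag-n22-c g4's module 13 carries the STRIP ∕ level-T currency at this reading (canonical θ-form); this module carries module 7's analytic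
currency (A) and the regime ∕ tuple home, importing their coherence theorem.

WHAT THIS MODULE PROVES ([folklore] bookkeeping; every estimate stays a displayed hypothesis).
* §1 θ-form **`n22At_u3OfRecord₁₂_ofRecordAdm_of_n18Below_analytic`** — at ONE Stage-12 tuple and run length `k`, for `D := ReadingData.ofRecordAdm F θ.τ9.M N S sp …`:
  `N18At` below `k` + (J) for the towers `S` (functional level) + the analytic letter (A) at run length `k` for `Re E^{(j)}_{S k}(X; ·; (ιU, 0))`, `U` ADMISSIBLE
  (module 4's `hA` literal) + the eleven numerals + `0 < θ.γ` ⟹ `N22At (u3OfRecord₁₂ θ (D.u3Objects θ.γ) k)` — module 7 §2 with (C1)(C2) by name (`pairingCoherence_ofRecordAdm`).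
* §2 stub level at the reading of record, edition 1 (module 6's `readingOfRecord₁₂ w1 ℓ₃ ne2 ne1` with
  `w1 F θ := ReadingData.ofRecordAdm F θ.τ9.M N (S F θ) (sp F θ) (gauge F θ) (hg F θ) (T₀ F θ) (hT₀ F θ) (li F θ)`):
  **`s_N22_readingOfRecord₁₂On_ofRecordAdm_of_s_N18_stripBound`** (regime ∕ tuple home `RRec₁₂On 𝔯 Rg`, any `Rg`, STRIP currency — the strip bound asked for the
  reading's OWN table `sp F θ k`, NO readings clause) · **`s_N22_readingOfRecord₁₂_ofRecordAdm_of_s_N18_analytic`** (canonical home, (A)) ·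
  **`s_N22_readingOfRecord₁₂On_ofRecordAdm_of_s_N18_analytic`** (regime home, (A)).

HONEST FRAMING.  COUNT-NEUTRAL kernel bookkeeping BY NAME; NE5 ∕ NE9 NOT PRINTED for d = 4 ([Balaban1987RG1] Thm 1 p. 259: uniformity in the lattice spacing only; p. 263
«C^∞ (or analytic)» in the last coupling) and NOT PROVED; `S_N18`, (J), STRIP ∕ (A) and the numerals are DISPLAYED hypotheses; the towers `S`, the table family `sp`, the
gauge, `T₀` and its admissibility-preservation clause `hT₀` ([Balaban1987RG1] (0.21)–(0.22) ∕ Lemma 1 content) are PARAMETERS of the reading; `AdmBg … k` may be EMPTY for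
a badly chosen table (then everything here is vacuous — A1-visible; `AdmBg.nonempty_of_mem`); termless towers satisfy everything (INHABITATION IS NOT CONTENT); nothing of
Bałaban's is asserted; no inhabitant of any Stage-12 key claimed (K0″ open); N22 NOT discharged; counts UNMOVED (typed 28∕28 · discharged 5∕27, A 5∕28); one finite
four-torus programme at fixed `ε` — NOT ℝ⁴, NOT infinite volume, NOT OS, NOT a mass gap, NOT Clay.  No decl carries a cite tag.
-/

noncomputable section

namespace YMDAG.N22

open Set Metric
open scoped BigOperators
open Literature.MathematicalPhysics.QuantumFieldTheory.Balaban1983to89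
open Literature.MathematicalPhysics.QuantumFieldTheory.Balaban1983to89.T4Continuum
open Literature.MathematicalPhysics.QuantumFieldTheory.Balaban1983to89.T4OutputRate
open Literature.MathematicalPhysics.QuantumFieldTheory.Balaban1983to89.TreeLengthTorus (torusTreeLen)
open Literature.MathematicalPhysics.QuantumFieldTheory.Balaban1983to89.Node00
  (Stage12Params NE2Objects₁₁ NE3Letters₁₁ MatA ιSU)
open Literature.MathematicalPhysics.QuantumFieldTheory.Balaban1983to89.Node00.Sect2 (domSys CPair ofBackgroundC)
open Literature.MathematicalPhysics.QuantumFieldTheory.Balaban1983to89.Node00.W1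
  (ReadingData LetterInputs ClusterTower functionalC termC AdmBg)
open YMDAG.UVSplit
open YMDAG.N22.W1 (pairingCoherence_ofRecordAdm)

variable {N : ℕ} [NeZero N]

/-! ## §1 θ-form: N18 below `k` ⇒ N22 at `k` at the admissible reading, analytic sup-letter currency -/

section Theta

variable {F : T4Family} (θ : Stage12Params F N) (S : (k : ℕ) → ClusterTower (F.P k) (MatA N) θ.τ9.M)
  (sp : (k j : ℕ) → (domSys (F.P k) θ.τ9.M j).Dom → Set (CPair (F.P k) (MatA N)))
  (gauge : (k : ℕ) → GaugeField (F.P k) 0 (Node00.SU N) → GaugeField (F.P k) 0 (Node00.SU N) → ℝ) (hg : ∀ k U U', 0 ≤ gauge k U U')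
  (T₀ : (k : ℕ) → GaugeField (F.P (k + 1)) 0 (Node00.SU N) → GaugeField (F.P k) 0 (Node00.SU N))
  (hT₀ : ∀ (k : ℕ) (U : GaugeField (F.P (k + 1)) 0 (Node00.SU N)),
    (∀ (j : ℕ) (Y : (domSys (F.P (k + 1)) θ.τ9.M j).Dom), ofBackgroundC (ιSU N) U ∈ sp (k + 1) j Y) →
    ∀ (j : ℕ) (Y : (domSys (F.P k) θ.τ9.M j).Dom), ofBackgroundC (ιSU N) (T₀ k U) ∈ sp k j Y)
  (li : LetterInputs) (k : ℕ)

/-- **N18 BELOW `k` ⇒ N22 AT `k` AT THE ADMISSIBLE READING OF RECORD, ONE STAGE-12 TUPLE, ANALYTIC SUP-LETTER CURRENCY.**  For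
`D := ReadingData.ofRecordAdm F θ.τ9.M N S sp gauge hg T₀ hT₀ li`: `N18At` at the bundles `u3OfRecord₁₂ θ (D.u3Objects θ.γ) k′`, `k′ < k`; the pin (J) «no term after the run»
for the towers `S` (functional level, every background); the analytic letter (A) at run length `k` — per ADMISSIBLE background `U : AdmBg F θ.τ9.M N sp k`, domain `(j, X)` and
young coupling `i < j` a complex-differentiable extension of `t ↦ Re E^{(j)}_{S k}(X; g[i ↦ t]; (ιU, 0))` on a set containing the closed `li.r`-discs about `]0, θ.γ]`, sup letter
`li.A·li.μ^{j−1−i}·e^{−li.κ d_j(X)}` (module 4's `hA` literal); the eleven numerals; `0 < θ.γ` ⟹ `N22At (u3OfRecord₁₂ θ (D.u3Objects θ.γ) k)`.  Module 7 §2 with the pairing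
coherence (C1)(C2) discharged BY NAME (dag-n22-c's `pairingCoherence_ofRecordAdm`). [folklore] -/
theorem n22At_u3OfRecord₁₂_ofRecordAdm_of_n18Below_analytic
    (h18 : ∀ k' : ℕ, k' < k →
      N18At (u3OfRecord₁₂ θ ((ReadingData.ofRecordAdm F θ.τ9.M N S sp gauge hg T₀ hT₀ li).u3Objects θ.γ) k'))
    (hjunk : ∀ (k : ℕ) (X : Node00.W1.Dom (F.P k) θ.τ9.M), k < X.1 → ∀ (g : ℕ → ℝ) (φ : CPair (F.P k) (MatA N)), functionalC (S k) g φ X = 0)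
    (hA : ∀ g ∈ Window θ.γ, ∀ (U : AdmBg F θ.τ9.M N sp k) (X : Node00.W1.Dom (F.P k) θ.τ9.M) (i : ℕ), i < X.1 →
      ∃ (Fz : ℂ → ℂ) (Dset : Set ℂ), DifferentiableOn ℂ Fz Dset ∧
        (∀ z ∈ Dset, ‖Fz z‖ ≤ li.A * li.μ ^ (X.1 - 1 - i) * Real.exp (-(li.κ * (domSys (F.P k) θ.τ9.M X.1).dj X.2))) ∧
        (∀ t ∈ Ioc (0 : ℝ) θ.γ, closedBall (t : ℂ) li.r ⊆ Dset) ∧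
        (∀ t ∈ Ioc (0 : ℝ) θ.γ, Fz t = ((functionalC (S k) (Function.update g i t) (ofBackgroundC (ιSU N) U.1) X).re : ℂ)))
    (hnum : 0 < li.C₀ ∧ 0 < li.θ₅ ∧ li.θ₅ < 1 ∧ 0 ≤ li.C₅ ∧ 2 * li.C₅ / (1 - li.θ₅) ≤ li.C₀ ∧ 0 < li.A ∧ li.θ₅ ≤ li.μ ∧
      li.C₀ ≤ 2 * li.A ∧ 0 < li.r ∧ 0 < li.s ∧ li.s < 1)
    (hγ : 0 < θ.γ) :
    N22At (u3OfRecord₁₂ θ ((ReadingData.ofRecordAdm F θ.τ9.M N S sp gauge hg T₀ hT₀ li).u3Objects θ.γ) k) := by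
  obtain ⟨hfst, hdj, hsurj, hbg⟩ := pairingCoherence_ofRecordAdm (N := N) S sp gauge hg T₀ hT₀ li
  refine n22At_u3OfRecord₁₂_w1_of_n18Below_analytic θ (ReadingData.ofRecordAdm F θ.τ9.M N S sp gauge hg T₀ hT₀ li) k h18
    hfst hdj hsurj hbg (fun k g U X hk => ?_) (fun g hg' U X i hi => hA g hg' U X i hi) hnum hγ
  show (functionalC (S k) g (ofBackgroundC (ιSU N) U.1) X).re = 0
  rw [hjunk k X hk]
  simp

end Theta

/-! ## §2 Stub level at the reading of record, edition 1, with the admissible W1 component -/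

section Stub

variable (S : (F : T4Family) → (θ : Stage12Params F N) → (k : ℕ) → ClusterTower (F.P k) (MatA N) θ.τ9.M)
  (sp : (F : T4Family) → (θ : Stage12Params F N) → (k j : ℕ) → (domSys (F.P k) θ.τ9.M j).Dom → Set (CPair (F.P k) (MatA N)))
  (gauge : (F : T4Family) → (θ : Stage12Params F N) → (k : ℕ) → GaugeField (F.P k) 0 (Node00.SU N) → GaugeField (F.P k) 0 (Node00.SU N) → ℝ)
  (hg : ∀ (F : T4Family) (θ : Stage12Params F N) (k : ℕ) (U U' : GaugeField (F.P k) 0 (Node00.SU N)), 0 ≤ gauge F θ k U U')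
  (T₀ : (F : T4Family) → (θ : Stage12Params F N) → (k : ℕ) → GaugeField (F.P (k + 1)) 0 (Node00.SU N) → GaugeField (F.P k) 0 (Node00.SU N))
  (hT₀ : ∀ (F : T4Family) (θ : Stage12Params F N) (k : ℕ) (U : GaugeField (F.P (k + 1)) 0 (Node00.SU N)),
    (∀ (j : ℕ) (Y : (domSys (F.P (k + 1)) θ.τ9.M j).Dom), ofBackgroundC (ιSU N) U ∈ sp F θ (k + 1) j Y) →
    ∀ (j : ℕ) (Y : (domSys (F.P k) θ.τ9.M j).Dom), ofBackgroundC (ιSU N) (T₀ F θ k U) ∈ sp F θ k j Y)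
  (li : (F : T4Family) → Stage12Params F N → LetterInputs) (ℓ₃ : T4Family → NE3Letters₁₁)
  (ne2 : (F : T4Family) → Stage12Params F N → (ℕ → ℝ) → List (ULoop F) → ℕ → NE2Objects₁₁)
  (ne1 : (F : T4Family) → Stage12Params F N → (ℕ → ℝ) → List (ULoop F) → NE1pCarriers)

open Classical in
/-- **THE EDGE N18 → N22 AT THE READING OF RECORD WITH THE ADMISSIBLE W1 COMPONENT, REGIME ∕ TUPLE HOME, STRIP CURRENCY.**  For ANY regime `Rg` and
`𝔯 := readingOfRecord₁₂ (fun F θ ↦ ReadingData.ofRecordAdm F θ.τ9.M N (S F θ) (sp F θ) …) ℓ₃ ne2 ne1`: `S_N18 (RRec₁₂On 𝔯 Rg)` + per admissible Stage-12 tuple with provisos IN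
`Rg`: the pin (J) for the towers `S F θ`, dag-n22-c's twelve numerals, and per run length `k` STRIP-(1.18) for the terms `E^{(j)}_{S F θ k}(Y; ·; ψ)` at the configurations
`ψ` of the reading's OWN table `sp F θ k` (young-coupling sections extend holomorphically to an open set ⊇ the closed `li.r`-discs about `]0, θ.γ]`, bound `li.A·e^{−li.κ·ℓ(Y)}`)
⟹ `S_N22 (RRec₁₂On 𝔯 Rg)`.  Module 7 §1 with `hcoh` := dag-n22-c's `pairingCoherence_ofRecordAdm` + (J) and the readings clause BY TYPE (`U.2`). [folklore] -/
theorem s_N22_readingOfRecord₁₂On_ofRecordAdm_of_s_N18_stripBound (Rg : (F : T4Family) → Stage12Params F N → Prop)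
    (h18 : S_N18 (RRec₁₂On (readingOfRecord₁₂
      (fun F θ => ReadingData.ofRecordAdm F θ.τ9.M N (S F θ) (sp F θ) (gauge F θ) (hg F θ) (T₀ F θ) (hT₀ F θ) (li F θ)) ℓ₃ ne2 ne1) Rg))
    (hjunk : ∀ (F : T4Family) (θ : Stage12Params F N), θ.Provisos₁₂ F N → Rg F θ → θ.Admissible F N →
      ∀ (k : ℕ) (X : Node00.W1.Dom (F.P k) θ.τ9.M), k < X.1 → ∀ (g : ℕ → ℝ) (φ : CPair (F.P k) (MatA N)), functionalC (S F θ k) g φ X = 0)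
    (hnum : ∀ (F : T4Family) (θ : Stage12Params F N), θ.Provisos₁₂ F N → Rg F θ → θ.Admissible F N →
      0 < (li F θ).C₀ ∧ 0 < (li F θ).θ₅ ∧ (li F θ).θ₅ < 1 ∧ 0 ≤ (li F θ).C₅ ∧ 2 * (li F θ).C₅ / (1 - (li F θ).θ₅) ≤ (li F θ).C₀ ∧ 0 < (li F θ).A ∧
        (li F θ).θ₅ ≤ (li F θ).μ ∧ (li F θ).C₀ ≤ 2 * (li F θ).A ∧ 0 < (li F θ).r ∧ 0 < (li F θ).s ∧ (li F θ).s < 1 ∧ 1 ≤ (li F θ).μ)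
    (hstrip : ∀ (F : T4Family) (θ : Stage12Params F N), θ.Provisos₁₂ F N → Rg F θ → θ.Admissible F N → ∀ (k : ℕ),
      ∀ (j : ℕ) (g : ℕ → ℝ), g ∈ Window θ.γ → ∀ (i : ℕ) (Y : (domSys (F.P k) θ.τ9.M j).Dom) (ψ : CPair (F.P k) (MatA N)), ψ ∈ sp F θ k j Y →
        ∃ (Ec : ℂ → ℂ) (O : Set ℂ), IsOpen O ∧ (∀ t ∈ Ioc (0 : ℝ) θ.γ, closedBall (t : ℂ) (li F θ).r ⊆ O) ∧ DifferentiableOn ℂ Ec O ∧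
          (∀ z ∈ O, ‖Ec z‖ ≤ (li F θ).A * Real.exp (-((li F θ).κ * torusTreeLen Y.1))) ∧
          (∀ t ∈ Ioc (0 : ℝ) θ.γ, Ec t = termC (S F θ k) j Y (Function.update g i t) ψ)) :
    S_N22 (RRec₁₂On (readingOfRecord₁₂
      (fun F θ => ReadingData.ofRecordAdm F θ.τ9.M N (S F θ) (sp F θ) (gauge F θ) (hg F θ) (T₀ F θ) (hT₀ F θ) (li F θ)) ℓ₃ ne2 ne1) Rg) := by
  refine s_N22_rRec₁₂On_w1Assignment_of_s_N18_stripBound _ ne1 Rg h18 (fun F θ hP hRg hθ => ?_) hnum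
    (fun F θ hP hRg hθ k => ⟨sp F θ k, fun j U Y => U.2 j Y, hstrip F θ hP hRg hθ k⟩)
  obtain ⟨hfst, hdj, hsurj, hbg⟩ := pairingCoherence_ofRecordAdm (N := N) (S F θ) (sp F θ) (gauge F θ) (hg F θ) (T₀ F θ) (hT₀ F θ) (li F θ)
  refine ⟨hfst, hdj, hsurj, hbg, fun k g U X hk => ?_⟩
  show (functionalC (S F θ k) g (ofBackgroundC (ιSU N) U.1) X).re = 0
  rw [hjunk F θ hP hRg hθ k X hk]
  simp

/-- **THE EDGE AT THE READING OF RECORD WITH THE ADMISSIBLE W1 COMPONENT, CANONICAL HOME, ANALYTIC SUP-LETTER CURRENCY** — `S_N18 (RRec₁₂ 𝔯)` + per admissible tuple with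
provisos: (J), the eleven numerals, and per run length the analytic letter (A) for `Re E^{(j)}_{S F θ k}(X; ·; (ιU, 0))`, `U` ADMISSIBLE (module 4's `hA` literal) ⟹
`S_N22 (RRec₁₂ 𝔯)`.  Module 7's `s_N22_readingOfRecord₁₂_of_s_N18_analytic` with `hcoh` := `pairingCoherence_ofRecordAdm` + (J). [folklore] -/
theorem s_N22_readingOfRecord₁₂_ofRecordAdm_of_s_N18_analytic
    (h18 : S_N18 (RRec₁₂ (readingOfRecord₁₂
      (fun F θ => ReadingData.ofRecordAdm F θ.τ9.M N (S F θ) (sp F θ) (gauge F θ) (hg F θ) (T₀ F θ) (hT₀ F θ) (li F θ)) ℓ₃ ne2 ne1)))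
    (hjunk : ∀ (F : T4Family) (θ : Stage12Params F N), θ.Provisos₁₂ F N → θ.Admissible F N →
      ∀ (k : ℕ) (X : Node00.W1.Dom (F.P k) θ.τ9.M), k < X.1 → ∀ (g : ℕ → ℝ) (φ : CPair (F.P k) (MatA N)), functionalC (S F θ k) g φ X = 0)
    (hA : ∀ (F : T4Family) (θ : Stage12Params F N), θ.Provisos₁₂ F N → θ.Admissible F N → ∀ (k : ℕ),
      ∀ g ∈ Window θ.γ, ∀ (U : AdmBg F θ.τ9.M N (sp F θ) k) (X : Node00.W1.Dom (F.P k) θ.τ9.M) (i : ℕ), i < X.1 →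
        ∃ (Fz : ℂ → ℂ) (Dset : Set ℂ), DifferentiableOn ℂ Fz Dset ∧
          (∀ z ∈ Dset, ‖Fz z‖ ≤ (li F θ).A * (li F θ).μ ^ (X.1 - 1 - i) * Real.exp (-((li F θ).κ * (domSys (F.P k) θ.τ9.M X.1).dj X.2))) ∧
          (∀ t ∈ Ioc (0 : ℝ) θ.γ, closedBall (t : ℂ) (li F θ).r ⊆ Dset) ∧
          (∀ t ∈ Ioc (0 : ℝ) θ.γ, Fz t = ((functionalC (S F θ k) (Function.update g i t) (ofBackgroundC (ιSU N) U.1) X).re : ℂ)))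
    (hnum : ∀ (F : T4Family) (θ : Stage12Params F N), θ.Provisos₁₂ F N → θ.Admissible F N →
      0 < (li F θ).C₀ ∧ 0 < (li F θ).θ₅ ∧ (li F θ).θ₅ < 1 ∧ 0 ≤ (li F θ).C₅ ∧ 2 * (li F θ).C₅ / (1 - (li F θ).θ₅) ≤ (li F θ).C₀ ∧ 0 < (li F θ).A ∧
        (li F θ).θ₅ ≤ (li F θ).μ ∧ (li F θ).C₀ ≤ 2 * (li F θ).A ∧ 0 < (li F θ).r ∧ 0 < (li F θ).s ∧ (li F θ).s < 1) :
    S_N22 (RRec₁₂ (readingOfRecord₁₂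
      (fun F θ => ReadingData.ofRecordAdm F θ.τ9.M N (S F θ) (sp F θ) (gauge F θ) (hg F θ) (T₀ F θ) (hT₀ F θ) (li F θ)) ℓ₃ ne2 ne1)) := by
  refine s_N22_readingOfRecord₁₂_of_s_N18_analytic ne1 _ ℓ₃ ne2 h18 (fun F θ hP hθ => ?_)
    (fun F θ hP hθ k g hg' U X i hi => hA F θ hP hθ k g hg' U X i hi) hnum
  obtain ⟨hfst, hdj, hsurj, hbg⟩ := pairingCoherence_ofRecordAdm (N := N) (S F θ) (sp F θ) (gauge F θ) (hg F θ) (T₀ F θ) (hT₀ F θ) (li F θ)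
  refine ⟨hfst, hdj, hsurj, hbg, fun k g U X hk => ?_⟩
  show (functionalC (S F θ k) g (ofBackgroundC (ιSU N) U.1) X).re = 0
  rw [hjunk F θ hP hθ k X hk]
  simp

/-- **THE SAME AT THE REGIME ∕ TUPLE HOME** `RRec₁₂On 𝔯 Rg` (any `Rg`), analytic currency — module 7's `s_N22_rRec₁₂On_w1_of_s_N18_analytic` at
`𝔇 := pinnedInputs₁₂ (fun F θ ↦ ReadingData.ofRecordAdm …) ℓ₃ ne2`, `hcoh` := `pairingCoherence_ofRecordAdm` + (J). [folklore] -/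
theorem s_N22_readingOfRecord₁₂On_ofRecordAdm_of_s_N18_analytic (Rg : (F : T4Family) → Stage12Params F N → Prop)
    (h18 : S_N18 (RRec₁₂On (readingOfRecord₁₂
      (fun F θ => ReadingData.ofRecordAdm F θ.τ9.M N (S F θ) (sp F θ) (gauge F θ) (hg F θ) (T₀ F θ) (hT₀ F θ) (li F θ)) ℓ₃ ne2 ne1) Rg))
    (hjunk : ∀ (F : T4Family) (θ : Stage12Params F N), θ.Provisos₁₂ F N → Rg F θ → θ.Admissible F N →
      ∀ (k : ℕ) (X : Node00.W1.Dom (F.P k) θ.τ9.M), k < X.1 → ∀ (g : ℕ → ℝ) (φ : CPair (F.P k) (MatA N)), functionalC (S F θ k) g φ X = 0)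
    (hA : ∀ (F : T4Family) (θ : Stage12Params F N), θ.Provisos₁₂ F N → Rg F θ → θ.Admissible F N → ∀ (k : ℕ),
      ∀ g ∈ Window θ.γ, ∀ (U : AdmBg F θ.τ9.M N (sp F θ) k) (X : Node00.W1.Dom (F.P k) θ.τ9.M) (i : ℕ), i < X.1 →
        ∃ (Fz : ℂ → ℂ) (Dset : Set ℂ), DifferentiableOn ℂ Fz Dset ∧
          (∀ z ∈ Dset, ‖Fz z‖ ≤ (li F θ).A * (li F θ).μ ^ (X.1 - 1 - i) * Real.exp (-((li F θ).κ * (domSys (F.P k) θ.τ9.M X.1).dj X.2))) ∧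
          (∀ t ∈ Ioc (0 : ℝ) θ.γ, closedBall (t : ℂ) (li F θ).r ⊆ Dset) ∧
          (∀ t ∈ Ioc (0 : ℝ) θ.γ, Fz t = ((functionalC (S F θ k) (Function.update g i t) (ofBackgroundC (ιSU N) U.1) X).re : ℂ)))
    (hnum : ∀ (F : T4Family) (θ : Stage12Params F N), θ.Provisos₁₂ F N → Rg F θ → θ.Admissible F N →
      0 < (li F θ).C₀ ∧ 0 < (li F θ).θ₅ ∧ (li F θ).θ₅ < 1 ∧ 0 ≤ (li F θ).C₅ ∧ 2 * (li F θ).C₅ / (1 - (li F θ).θ₅) ≤ (li F θ).C₀ ∧ 0 < (li F θ).A ∧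
        (li F θ).θ₅ ≤ (li F θ).μ ∧ (li F θ).C₀ ≤ 2 * (li F θ).A ∧ 0 < (li F θ).r ∧ 0 < (li F θ).s ∧ (li F θ).s < 1) :
    S_N22 (RRec₁₂On (readingOfRecord₁₂
      (fun F θ => ReadingData.ofRecordAdm F θ.τ9.M N (S F θ) (sp F θ) (gauge F θ) (hg F θ) (T₀ F θ) (hT₀ F θ) (li F θ)) ℓ₃ ne2 ne1) Rg) := by
  refine s_N22_rRec₁₂On_w1_of_s_N18_analytic _ ne1 Rg h18 (fun F θ hP hRg hθ => ?_)
    (fun F θ hP hRg hθ k g hg' U X i hi => hA F θ hP hRg hθ k g hg' U X i hi) hnum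
  obtain ⟨hfst, hdj, hsurj, hbg⟩ := pairingCoherence_ofRecordAdm (N := N) (S F θ) (sp F θ) (gauge F θ) (hg F θ) (T₀ F θ) (hT₀ F θ) (li F θ)
  refine ⟨hfst, hdj, hsurj, hbg, fun k g U X hk => ?_⟩
  show (functionalC (S F θ k) g (ofBackgroundC (ιSU N) U.1) X).re = 0
  rw [hjunk F θ hP hRg hθ k X hk]
  simp

end Stub

end YMDAG.N22

end
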